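import Summits.MatrixMultiplication.OmegaCensus.STPPZoo313DiffSeq
import Summits.MatrixMultiplication.OmegaCensus.STPPZoo313CountSound
import Summits.MatrixMultiplication.OmegaCensus.STPPZoo313TableP4
import Summits.MatrixMultiplication.OmegaCensus.STPPVosperSlackTwoCheckersSound

/-!
# ω-census (abelian STPP census): the (3,13)@61 TWO-ABOVE ZOO THEOREM modulo its kernel rows (fifth ℤ₆₁ leaf, cell (2,2))

HONEST FRAMING (pub-omega census; verbatim): lottery ticket; floor = certified bounds/negative ranges.
Census STRUCTURE (seat pub-omega-stpp-1 gen 33, 2026-08-29), family (b2).  `zoo313_61_of_rows`: IF the root row of the zoo checker holds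
(`zooGo 61 zooTbl61 12 59 3 0 1 [0] = true` — to be assembled from ≈ 300 batched `decide` rows ≈ 2.8 h of kernel, HOME
`pub-omega-stpp-1-g33/code/zoo_rows_plan.json`), THEN every pair in normal form — `Y ⊆ ℤ/61`, `|Y| = 13`, `0 ∈ Y`, `60 ∉ Y`, `2 ≤ y.val ≤ 59`,
`|{0, 1, y} + Y| = 17` — is a table entry `(y.val, maskOf (values of Y))` of `zooTbl61` (2 562 pairs; `y` in the anharmonic classes of 2, 3, 4 only).
Assembles the four soundness pieces: difference sequences (`STPPZoo313DiffSeq.lean`), generator completeness (`STPPZoo313CheckerSound.lean`), counter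
semantics (`STPPZoo313CounterSound.lean`), the counting identity (`STPPZoo313CountSound.lean`).  No `decide`.  Nothing here is progress on `ω`.

References: H. Cohn, R. Kleinberg, B. Szegedy, C. Umans, FOCS 2005 (arXiv:math/0511460), Def. 5.1.
-/

open Finset
open scoped Pointwise

namespace Summit.MatrixMultiplication.OmegaCensus.CubeNB.S2

open Summit.MatrixMultiplication.OmegaCensus.CubeNB.Bits

/-- Bits `2 ≤ v ≤ p − 2` of the `y`-range mask are set. [folklore] -/
theorem tb_yRangeMask {p v : ℕ} (h2 : 2 ≤ v) (hv : v + 2 ≤ p) : tb (yRangeMask p) v = true := by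
  unfold yRangeMask
  rw [tb_xor, tb_xor, tb_fullMask, decide_eq_true (by omega : v < p), tb_eq_testBit 3, tb_eq_testBit (1 <<< (p - 1)),
    Nat.testBit_shiftLeft, decide_eq_false (by omega : ¬ (p - 1 ≤ v)), Bool.false_and]
  have h3 : Nat.testBit 3 v = false := Nat.testBit_lt_two_pow (by
    have : (4 : ℕ) ≤ 2 ^ v := by
      calc (4 : ℕ) = 2 ^ 2 := by norm_num
        _ ≤ 2 ^ v := Nat.pow_le_pow_right (by norm_num) h2
    omega)
  rw [h3]; rfl

/-- `failCount` is invariant under reversing the list of masks. [folklore] -/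
theorem failCount_reverse (Ss : List ℕ) (y : ℕ) : failCount Ss.reverse y = failCount Ss y := by
  unfold failCount; rw [List.filter_reverse, List.length_reverse]

/-- **Reading the leaf verdict**: if `zooLeaf p tbl K mask els = true` and `y < p` has its bit set in the masked last counter, then `(y, mask) ∈ tbl`.
[folklore] -/
theorem mem_of_zooLeaf {p : ℕ} {tbl : List (ℕ × ℕ)} {K mask : ℕ} {els : List ℕ} {y : ℕ} (h : zooLeaf p tbl K mask els = true) (hyp : y < p)
    (hy : tb ((els.foldl (fun cs b => stepCnt p ((((mask ||| (mask <<< 1)) ||| ((mask ||| (mask <<< 1)) <<< p)) >>> b) &&& fullMask p) cs)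
      (fullMask p :: List.replicate K 0)).getLastD 0 &&& yRangeMask p) y = true) : (y, mask) ∈ tbl := by
  unfold zooLeaf at h
  simp only [Bool.or_eq_true, List.all_eq_true, decide_eq_true_eq] at h
  rcases h with h0 | hall
  · have hz := Nat.eq_of_beq_eq_true h0
    rw [hz, tb_zero] at hy
    exact Bool.noConfusion hy
  · exact hall y (mem_members.2 ⟨List.mem_range.2 hyp, hy⟩)

/-- **THE (3,13)@61 ZOO THEOREM modulo the root row.**  See the module docstring. [cite: CohnKleinbergSzegedyUmans2005, Def. 5.1] -/
theorem zoo313_61_of_rows (hrows : zooGo 61 zooTbl61 12 59 3 0 1 [0] = true)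
    (Y : Finset (ZMod 61)) (y : ZMod 61) (hY : #Y = 13) (h0 : (0 : ZMod 61) ∈ Y) (h60 : (60 : ZMod 61) ∉ Y)
    (hy2 : 2 ≤ y.val) (hy59 : y.val ≤ 59) (h17 : #(({0, 1, y} : Finset (ZMod 61)) + Y) = 17) :
    (y.val, maskOf ((Y.image ZMod.val).sort (· ≤ ·))) ∈ zooTbl61 := by
  haveI : Fact (Nat.Prime 61) := ⟨by norm_num⟩
  obtain ⟨hmem, hnd, hlt, hlen⟩ := valList_spec (p := 61) Y
  rw [hY] at hlen
  set vs := (Y.image ZMod.val).sort (· ≤ ·) with hvsdef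
  have hpw : vs.Pairwise (· < ·) := List.sortedLT_iff_pairwise.1 (Finset.sortedLT_sort _)
  -- every value is ≤ 59 (60 ∉ Y)
  have h59 : ∀ v ∈ vs, v ≤ 59 := by
    intro v hv
    obtain ⟨e, he, rfl⟩ := (hmem v).1 hv
    have hne : e.val ≠ 60 := fun h => h60 (by
      have : e = 60 := by apply ZMod.val_injective 61; rw [h]; rfl
      rwa [← this])
    have := e.val_lt; omega
  -- the list starts with `0`
  obtain ⟨a, t, hvt⟩ : ∃ a t, vs = a :: t := by
    rcases hv : vs with _ | ⟨a, t⟩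
    · rw [hv] at hlen; simp at hlen
    · exact ⟨a, t, rfl⟩
  have h0mem : (0 : ℕ) ∈ vs := (hmem 0).2 ⟨0, h0, ZMod.val_zero⟩
  have ha : a = 0 := by
    rw [hvt, List.mem_cons] at h0mem
    rcases h0mem with h | h
    · exact h.symm
    · rw [hvt, List.pairwise_cons] at hpw
      have := hpw.1 0 h; omega
  subst ha
  -- the difference sequence
  set ds := diffs (0 :: t) with hdsdef
  have hpw' : (0 :: t).Pairwise (· < ·) := by rwa [hvt] at hpw
  have helems : elemsFrom ds 0 = t := elemsFrom_diffs 0 t hpw'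
  have hpos : ∀ d ∈ ds, 1 ≤ d := diffs_pos 0 t hpw'
  have hdslen : ds.length = 12 := by
    rw [hdsdef, length_diffs]; rw [hvt] at hlen; simpa using hlen
  have hsum : ds.sum ≤ 59 := by
    have := sum_diffs_le 0 t 59 hpw' (by rw [← hvt]; exact h59); simpa using this
  -- run ends: `#(Y ∪ (Y+1)) = 13 + (1 + bigs)`
  set bigs := (ds.filter fun d => decide (2 ≤ d)).length with hbigsdef
  have hmax : ∀ v ∈ vs, v + 1 < 61 := fun v hv => by have := h59 v hv; omega
  set U1 := maskOf vs ||| (maskOf vs <<< 1) with hU1def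
  have hU1card : popc (List.range 61) U1 = #(Y ∪ Y.image (· + 1)) := by
    rw [popc_eq_length_members]
    have hndm : (members (List.range 61) U1).Nodup := nodup_members List.nodup_range _
    have hset : (members (List.range 61) U1).toFinset = (Y ∪ Y.image (· + 1)).image ZMod.val := by
      ext v
      rw [List.mem_toFinset, mem_members, List.mem_range, mem_image]
      constructor
      · rintro ⟨_, htb⟩; exact (tb_U1_iff hmem hmax v).1 htb
      · rintro ⟨e, he, rfl⟩; exact ⟨e.val_lt, (tb_U1_iff hmem hmax _).2 ⟨e, he, rfl⟩⟩
    rw [← List.toFinset_card_of_nodup hndm, hset, card_image_of_injective _ (ZMod.val_injective 61)]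
  have hunion : #(Y ∪ Y.image (· + 1)) = 13 + #(Y.filter fun e => e + 1 ∉ Y) := by
    have h := Finset.card_sdiff_add_card (s := Y.image (· + 1)) (t := Y)
    rw [union_comm] at h
    rw [← h, Finset.sdiff_eq_filter, Finset.filter_image, card_image_of_injective _ (add_left_injective (1 : ZMod 61)), hY,
      Nat.add_comm]
  have hends : #(Y.filter fun e => e + 1 ∉ Y) = 1 + bigs := by
    rw [hbigsdef, ← length_filter_succ_not_mem ds 0 hpos, helems, ← hvt]
    have hndf : (vs.filter fun v => !(vs.elem (v + 1))).Nodup := hnd.filter _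
    have hset : (vs.filter fun v => !(vs.elem (v + 1))).toFinset = (Y.filter fun e => e + 1 ∉ Y).image ZMod.val := by
      ext v
      rw [List.mem_toFinset, List.mem_filter, mem_image]
      constructor
      · rintro ⟨hv, hnot⟩
        obtain ⟨e, he, rfl⟩ := (hmem v).1 hv
        refine ⟨e, mem_filter.2 ⟨he, fun hin => ?_⟩, rfl⟩
        have hval : (e + 1).val = e.val + 1 := by
          rw [ZMod.val_add, ZMod.val_one, Nat.mod_eq_of_lt (hmax _ hv)]
        have : vs.elem (e.val + 1) = true := List.elem_eq_true_of_mem ((hmem _).2 ⟨e + 1, hin, hval⟩)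
        rw [this] at hnot; exact Bool.noConfusion hnot
      · rintro ⟨e, he, rfl⟩
        rw [mem_filter] at he
        have hv : e.val ∈ vs := (hmem _).2 ⟨e, he.1, rfl⟩
        refine ⟨hv, ?_⟩
        cases hel : vs.elem (e.val + 1)
        · rfl
        · exfalso
          obtain ⟨e', he', hev'⟩ := (hmem _).1 (List.mem_of_elem_eq_true hel)
          apply he.2
          have : e' = e + 1 := by
            apply ZMod.val_injective 61
            rw [hev', ZMod.val_add, ZMod.val_one, Nat.mod_eq_of_lt (hmax _ hv)]
          rw [← this]; exact he'
    rw [← List.toFinset_card_of_nodup hndf, hset, card_image_of_injective _ (ZMod.val_injective 61)]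
  -- the counting identity: 17 = popc U1 + failures
  have hcount := card_triple_add_masks Y y vs hmem hnd hmax
  rw [h17] at hcount
  have hU1val : popc (List.range 61) U1 = 14 + bigs := by rw [hU1card, hunion, hends]; omega
  rw [← hU1def, hU1val] at hcount
  have hbigs : bigs ≤ 3 := by omega
  have hfail : failCount (vs.map fun b => ((U1 ||| (U1 <<< 61)) >>> b) &&& fullMask 61) y.val = 3 - bigs := by omega
  -- the generator reaches the leaf of `ds`
  have hvalid : ZooValid 59 3 ds := zooValid_of ds 59 3 hpos hsum (by rw [← hbigsdef]; exact hbigs)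
  have hleaf := zooLeaf_of_zooGo 61 zooTbl61 ds 59 3 0 1 [0] hvalid (by rw [hdslen]; exact hrows)
  rw [zooRun_bb ds 3 0 1 [0] (by rw [← hbigsdef]; exact hbigs), zooRun_els, helems] at hleaf
  -- identify the mask
  have hmask : (zooRun ds (3, 0, 1, [0])).2.2.1 = maskOf vs := by
    apply Nat.eq_of_testBit_eq
    intro i
    rw [← tb_eq_testBit, ← tb_eq_testBit, Bool.eq_iff_iff, tb_zooRun_mask, helems, tb_maskOf, hvt, List.mem_cons,
      tb_eq_testBit, testBit_one_iff]
  rw [hmask, ← hbigsdef] at hleaf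
  -- read the leaf
  have hrev : t.reverse ++ [0] = vs.reverse := by rw [hvt, List.reverse_cons]
  rw [hrev] at hleaf
  set Sf : ℕ → ℕ := fun b => (((U1 ||| (U1 <<< 61)) >>> b) &&& fullMask 61) with hSf
  have hSlt : ∀ S ∈ vs.reverse.map Sf, S < 2 ^ 61 := by
    intro S hS
    obtain ⟨b, _, rfl⟩ := List.mem_map.1 hS
    exact succMask_lt _ b
  have hcntEq : vs.reverse.foldl (fun cs b => stepCnt 61 (Sf b) cs) (fullMask 61 :: List.replicate (3 - bigs) 0) =
      (vs.reverse.map Sf).foldl (fun cs S => stepCnt 61 S cs) (fullMask 61 :: List.replicate (3 - bigs) 0) := by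
    rw [List.foldl_map]
  have hbit : tb ((vs.reverse.foldl (fun cs b => stepCnt 61 (Sf b) cs) (fullMask 61 :: List.replicate (3 - bigs) 0)).getLastD 0) y.val =
      true := by
    rw [hcntEq, tb_getLastD_foldl_stepCnt 61 y.val (3 - bigs) _ hSlt]
    refine ⟨y.val_lt, ?_⟩
    rw [List.map_reverse, failCount_reverse]
    exact hfail
  refine mem_of_zooLeaf hleaf y.val_lt ?_
  rw [tb_land, Bool.and_eq_true]
  exact ⟨hbit, tb_yRangeMask hy2 (by omega)⟩

end Summit.MatrixMultiplication.OmegaCensus.CubeNB.S2
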